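import Mathlib.RingTheory.AdicCompletion.Noetherian
import Mathlib.RingTheory.Localization.Integral
import Mathlib.LinearAlgebra.Semisimple
import Mathlib.GroupTheory.QuotientGroup.Finite
import Literature.AlgebraicGeometry.Motives.FaltingsECCardProofs
import Literature.AlgebraicGeometry.Motives.FaltingsECTateLemma1Proofs
import Literature.NumberTheory.EllipticCurves.FrobeniusEndomorphism
import Literature.NumberTheory.EllipticCurves.FrobeniusTateModule
import Literature.NumberTheory.EllipticCurves.IsogenyCompProofs
import Literature.NumberTheory.EllipticCurves.TateModuleFinite
import HarnessLib

/-!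
# Tate's semisimplicity theorem for `V_ℓ E` over a finite field (proofs)

Proofs for the named fact `Literature.AlgebraicGeometry.Motives.isSemisimpleRepresentation_rationalGaloisRepTate_of_finite`
of `Literature.AlgebraicGeometry.Motives.FaltingsEC` (Tate, *Invent. Math.* 2 (1966), Main
Theorem and §2: for an elliptic curve `E` over a finite field `k` and any prime `ℓ`, the
`ℚ_ℓ[Γ_k]`-module `V_ℓ E` is semisimple). The whole `ℓ`-adic and Galois-theoretic part of Tate's
argument is carried out here (theorems only, no new definitions); the single geometric input —
that the Frobenius endomorphism `π` of `E` is algebraic over `ℤ`, i.e. that `End_k(E)` has finite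
rank — is isolated as the hypothesis of
`isSemisimpleRepresentation_rationalGaloisRepTate_of_exists_aeval_eq_zero` and then supplied
from either of the two places where the tree records it:

* `isSemisimpleRepresentation_rationalGaloisRepTate_of_finite_of_linearIndependent`: from
  Silverman's Thm. III.7.4 at one auxiliary prime `ℓ₀ ≠ char k`, in the form of the named fact
  `Literature.Hodge.linearIndependent_tateModule_map ℓ₀` of `FaltingsEC` (hence, by
  `linearIndependent_tateModule_map_of_facts₂` of `FaltingsECProofs`, from the two `IsogenyHom`
  facts *AEC* Cor. III.4.11 and `(*)` of III.7.4:
  `isSemisimpleRepresentation_rationalGaloisRepTate_of_finite_of_facts`);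
* `isSemisimpleRepresentation_rationalGaloisRepTate_of_finite_of_trace_det`: from the trace and
  determinant of Frobenius on `T_{ℓ₀} E`, `tr(φ_{ℓ₀}) = q + 1 - #E(k)` and `det(φ_{ℓ₀}) = q`
  (Silverman, Thm. V.2.3.1), by Cayley–Hamilton on the rank-two lattice `T_{ℓ₀} E` and a transfer
  principle `g(φ_{ℓ₀}) = 0 ⇒ g(π) = 0` (`Isogeny.aeval_eq_zero_of_aeval_tateEndRingHom_eq_zero`);
  hence from the four named facts of `EllipticCurves/FrobeniusEndomorphism` (*AEC* III.8.6,
  II.2.11(c), III.4.10(a), III.5.5) through its `trace/det_galoisRepTate_frobenius_of_facts`: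
  `isSemisimpleRepresentation_rationalGaloisRepTate_of_finite_of_frobenius_facts`.

In every case the conclusion is the named fact for *every* prime `ℓ`, including `ℓ = char k`.

## The argument (Tate 1966, §1–2, for `A = E` an elliptic curve)

Let `σ_q ∈ Γ_k` be the arithmetic Frobenius (`σ_q x = x ^ q` on `k̄`, hypothesis `hσ` as in
`FrobeniusEndomorphism`; it exists, `exists_frobenius_absoluteGaloisGroup` of
`FrobeniusTateModule`) and `π = φ ∈ End_k(E)` the `q`-power Frobenius endomorphism
(`WeierstrassCurve.frobeniusIsogeny`), which *is* the action of `σ_q` on `E(k̄)`, so that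
`ρ_ℓ(σ_q) = T_ℓ(π)` (`tateModule_map_frobeniusIsogeny`).

1. **Density.** Every `τ ∈ Γ_k` agrees with some power `σ_q ^ n` on any finite subset of `k̄`
   (the tree's `Literature.AlgebraicGeometry.Motives.exists_frobenius_pow_apply_eq` of `FaltingsECCardProofs`: Galois theory of the
   finite field generated by the subset), hence on any geometric point of `E` and on each
   component of an element of `T_ℓ E` (`exists_proj_smul_eq_proj_frobenius_pow_smul`) — the
   algebraic content of "`Γ_k ≅ Ẑ` is topologically generated by `σ_q`".
2. **Closure.** A `ℚ_ℓ`-subspace of `V_ℓ E` stable under `ρ(σ_q)` is stable under all of `Γ_k`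
   (`rationalGaloisRepTate_mem_of_frobenius`): by density `τ` agrees with a power of `σ_q` on
   each finite level `E[ℓⁿ]`, and `ℤ_ℓ`-submodules of the finitely generated module `T_ℓ E` are
   `ℓ`-adically closed (Krull's intersection theorem); denominators are cleared in
   `V_ℓ = ℚ_ℓ ⊗ T_ℓ`. Hence `V_ℓ E` is `Γ_k`-semisimple as soon as the single endomorphism
   `ρ(σ_q)` is semisimple (`isSemisimpleRepresentation_of_isSemisimple_frobenius`).
3. **Separability.** `Hom_k(E, E)` has no zero divisors (`eq_zero_or_eq_zero_of_comp_eq_zero`: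
   isogenies have finite kernels and `E(k̄)` is infinite; "`Hom` is a group" is proved in the
   tree), so if `π` satisfies a non-zero integer polynomial, one of least degree is irreducible
   over `ℚ`, hence separable (`Isogeny.exists_aeval_eq_zero_separable`); it kills
   `ρ_{V_ℓ}(σ_q) = V_ℓ(π)`, which is therefore a semisimple endomorphism
   (`isSemisimple_rationalGaloisRepTate_frobenius`, Mathlib
   `Module.End.isSemisimple_of_squarefree_aeval_eq_zero`). This is Tate's "`F = ℚ[π]` is
   semisimple, so `π` acts semisimply on `V_ℓ`".
4. **Algebraicity of `π`**, either (a) from III.7.4 at `ℓ₀ ≠ char k`: `ℤ`-independent isogenies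
   have `ℤ_{ℓ₀}`-independent images in `End(T_{ℓ₀} E) ≅ M₂(ℤ_{ℓ₀})` (rank `4`, the tree's
   `finrank_tateModule_eq_two`), so `1, π, …, π⁴` are dependent
   (`Isogeny.exists_aeval_eq_zero_of_linearIndependent`; Silverman Cor. III.7.5); or (b) from
   V.2.3.1:
   `φ_{ℓ₀}² - aφ_{ℓ₀} + q = 0` on `T_{ℓ₀} E` by Cayley–Hamilton, and an element of `Hom_k(E, E)`
   whose Tate-module map vanishes kills the infinite group `E[ℓ₀^∞]`, so is `0`
   (`Isogeny.aeval_eq_zero_of_aeval_tateEndRingHom_eq_zero`), giving `π² - aπ + q = 0` in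
   `End(E)` (Silverman, Thm. V.2.3.1(b)).

## From the tree

`FrobeniusEndomorphism` (`frobeniusIsogeny`, `tateModule_map_frobeniusIsogeny`, the `…_of_facts`
forms of Thm. V.2.3.1), `FrobeniusTateModule` (`exists_frobenius_absoluteGaloisGroup`, the named
facts `trace/det_galoisRepTate_frobenius`), `FaltingsECCardProofs` (density of Frobenius on finite
sets, `exists_prime_natCast_ne_zero`), `FaltingsECTateLemma1Proofs`
(`TateModule.exists_pow_smul_eq_of_proj_eq_zero`: `ker (T_ℓ → E[ℓⁿ]) = ℓⁿ T_ℓ`), `FaltingsECProofs`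
(`exists_proj_tateModule_eq`, `linearIndependent_tateModule_map_of_facts₂`), `IsogenyCompProofs`
and `IsogenyIdProofs` (`Isogeny.comp`, `Isogeny.id`), `IsogenyHomProofs`
(`mem_homModule_iff_holds`),
`TateModuleFinite`/`TateModuleFreeProofs`/`TateModuleFinrankProofs` (`T_ℓ E` finite free, of rank
two for `ℓ ≠ char`), `GaloisActionProofs` (`#E[m] = m²`). Mathlib: Krull's intersection theorem
(`IsHausdorff` for finite modules over the Noetherian local ring `ℤ_ℓ`),
`Module.End.isSemisimple_of_squarefree_aeval_eq_zero`, `Module.End.isSemisimple_iff`,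
`PerfectField.separable_iff_squarefree`, `IsLocalization.integerNormalization`,
`LinearMap.aeval_self_charpoly`, `Matrix.charpoly_fin_two`.

## Design choices

* Theorems only (no new definitions): an isogeny `φ : E → E`, in particular
  `π = frobeniusIsogeny W hσ`, is read as the element `⟨φ.toAddMonoidHom, _⟩` of the ring
  `W.endRing = End_K(E)`; its powers are realised as isogenies by iterating the tree's
  `Isogeny.comp` (`Isogeny.exists_toAddMonoidHom_eq_pow`), and polynomial identities are
  transported to `T_ℓ` by the tree's ring homomorphism `Literature.AlgebraicGeometry.Motives.tateEndRingHom` and to `V_ℓ` by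
  Mathlib's `Module.End.baseChangeHom`. The algebra of `ℤ[φ]` (separability of the minimal
  relation, semisimplicity of `V_ℓ(φ)`, the transfer principle, algebraicity from III.7.4) is
  proved for an arbitrary isogeny `φ ∈ End_K(E)` over any field, for reuse (e.g. CM curves).
* As in `FrobeniusEndomorphism`, the Frobenius is an arbitrary `σ ∈ Γ_k` with
  `hσ : ∀ x, σ • x = x ^ Nat.card k`; the final theorems produce such a `σ` themselves.
* `noncomputable section`, `open scoped Classical`, universe-monomorphic base field `k : Type u`
  as in the `EllipticCurves` preludes; `linearIndependent_tateModule_map.{u, 0}` is used with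
  index types in `Type` (only `Fin 5` is needed).

## References

* [Tate1966Endomorphisms] J. Tate, *Endomorphisms of abelian varieties over finite fields*,
  Invent. Math. 2 (1966), 134–144: Main Theorem, §1 (reduction to `T_ℓ(π)`), §2 (`F = ℚ[π]`
  semisimple, `π` acts semisimply on `V_ℓ`).
* [SilvermanAEC2009] J. H. Silverman, *The Arithmetic of Elliptic Curves*, 2nd ed., GTM 106
  (held copy `book:silverman1986-arithmetic-elliptic-curves`): Prop. III.4.2 (p. 69),
  Thm. III.7.4 and Cor. III.7.5 (pp. 86–87), Thm. V.2.3.1 (p. 139).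
* J.-P. Serre, *Abelian ℓ-adic representations and elliptic curves* (1968), I.1–I.2.
-/

noncomputable section

open scoped Classical
open scoped TensorProduct

universe u v

namespace Literature.AlgebraicGeometry.Motives

/-! ## Generic `ℓ`-adic lemmas on Tate modules -/

section TateModule
open Literature.NumberTheory.EllipticCurves (TateModule)
open Literature.NumberTheory.EllipticCurves.TateModule

variable {A : Type u} [AddCommGroup A] {p : ℕ} [Fact p.Prime]

/-- An element of `T_p A` whose `n`-th component vanishes lies in `𝔪 ^ n • T_p A`, `𝔪 = (p)` the
maximal ideal of `ℤ_p`. [folklore] -/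
theorem _root_.Literature.NumberTheory.EllipticCurves.TateModule.mem_pow_smul_top_of_proj_eq_zero {n : ℕ} {a : TateModule A p} (h : proj p n a = 0) :
    a ∈ (IsLocalRing.maximalIdeal ℤ_[p] ^ n • ⊤ : Submodule ℤ_[p] (TateModule A p)) := by
  obtain ⟨b, rfl⟩ := exists_pow_smul_eq_of_proj_eq_zero h
  refine Submodule.smul_mem_smul ?_ Submodule.mem_top
  rw [PadicInt.maximalIdeal_eq_span_p, Ideal.span_singleton_pow]
  exact Ideal.mem_span_singleton_self _

end TateModule

/-- **Closed submodules (Krull).** In a finitely generated module `M` over `ℤ_p`, a submodule `L`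
is `p`-adically closed: if `x` is congruent to an element of `L` modulo `𝔪 ^ n M` for every `n`,
then `x ∈ L` (Krull's intersection theorem `⋂ₙ 𝔪 ^ n (M / L) = 0` for the finitely generated
module `M / L` over the Noetherian local ring `ℤ_p`; Mathlib `IsHausdorff (maximalIdeal R) M`).
[folklore] -/
theorem mem_of_forall_exists_sub_mem_pow_smul_top {p : ℕ} [Fact p.Prime] {M : Type v}
    [AddCommGroup M] [Module ℤ_[p] M] [Module.Finite ℤ_[p] M] (L : Submodule ℤ_[p] M) {x : M}
    (h : ∀ n : ℕ, ∃ y ∈ L,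
      x - y ∈ (IsLocalRing.maximalIdeal ℤ_[p] ^ n • ⊤ : Submodule ℤ_[p] M)) : x ∈ L := by
  rw [← Submodule.Quotient.mk_eq_zero L]
  haveI : IsHausdorff (IsLocalRing.maximalIdeal ℤ_[p]) (M ⧸ L) := inferInstance
  refine IsHausdorff.haus ‹_› _ fun n ↦ SModEq.zero.mpr ?_
  obtain ⟨y, hy, hxy⟩ := h n
  have hmk : Submodule.Quotient.mk (p := L) x = L.mkQ (x - y) := by
    rw [Submodule.mkQ_apply, Submodule.Quotient.mk_sub, (Submodule.Quotient.mk_eq_zero L).mpr hy,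
      sub_zero]
  rw [hmk]
  have := Submodule.mem_map_of_mem (f := L.mkQ) hxy
  rwa [Submodule.map_smul'', Submodule.map_top, Submodule.range_mkQ] at this

section RationalTateModule
open Literature.NumberTheory.EllipticCurves (RationalTateModule)
open Literature.NumberTheory.EllipticCurves.RationalTateModule

variable {A : Type u} [AddCommGroup A] {p : ℕ} [Fact p.Prime]

/-- **Denominators in `ℚ_p ⊗ T`.** Every element of `ℚ_p ⊗_{ℤ_p} T` (for any `ℤ_p`-module `T`)
becomes a pure tensor `1 ⊗ x` after multiplication by a non-zero `p`-adic integer (`ℚ_p` is the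
fraction field of `ℤ_p`). [folklore] -/
theorem exists_smul_eq_one_tmul {T : Type v} [AddCommGroup T] [Module ℤ_[p] T]
    (v : ℚ_[p] ⊗[ℤ_[p]] T) :
    ∃ N : ℤ_[p], N ≠ 0 ∧ ∃ x : T, (N : ℚ_[p]) • v = (1 : ℚ_[p]) ⊗ₜ[ℤ_[p]] x := by
  induction v using TensorProduct.induction_on with
  | zero => exact ⟨1, one_ne_zero, 0, by rw [TensorProduct.tmul_zero, smul_zero]⟩
  | tmul c x =>
    obtain ⟨⟨a, s⟩, hs⟩ := IsLocalization.surj (nonZeroDivisors ℤ_[p]) c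
    refine ⟨s, nonZeroDivisors.coe_ne_zero s, a • x, ?_⟩
    rw [TensorProduct.smul_tmul', smul_eq_mul, mul_comm]
    change (c * algebraMap ℤ_[p] ℚ_[p] s) ⊗ₜ[ℤ_[p]] x = _
    rw [hs, Algebra.algebraMap_eq_smul_one, TensorProduct.smul_tmul]
  | add v w hv hw =>
    obtain ⟨N, hN, x, hx⟩ := hv
    obtain ⟨N', hN', x', hx'⟩ := hw
    have key : ∀ (M : ℤ_[p]) (y : T),
        (M : ℚ_[p]) • ((1 : ℚ_[p]) ⊗ₜ[ℤ_[p]] y) = (1 : ℚ_[p]) ⊗ₜ[ℤ_[p]] (M • y) := fun M y ↦ by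
      rw [TensorProduct.smul_tmul', smul_eq_mul, mul_one, ← TensorProduct.smul_tmul,
        Algebra.smul_def, mul_one]
      rfl
    refine ⟨N * N', mul_ne_zero hN hN', N' • x + N • x', ?_⟩
    rw [smul_add, PadicInt.coe_mul, mul_comm, mul_smul, hx, mul_comm, mul_smul, hx',
      TensorProduct.tmul_add, ← key, ← key]

/-- **Denominators in `V_p A = ℚ_p ⊗ T_p A`.** Every element of `V_p A` becomes integral after
multiplication by a non-zero `p`-adic integer: `N • v = 1 ⊗ x` for some `N ∈ ℤ_p ∖ {0}` and
`x ∈ T_p A`. Serre (1968), I.1.1. [folklore] -/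
theorem _root_.Literature.NumberTheory.EllipticCurves.RationalTateModule.exists_smul_eq_toRational (v : RationalTateModule A p) :
    ∃ N : ℤ_[p], N ≠ 0 ∧ ∃ x : Literature.NumberTheory.EllipticCurves.TateModule A p, (N : ℚ_[p]) • v = Literature.NumberTheory.EllipticCurves.TateModule.toRational p x :=
  exists_smul_eq_one_tmul v

end RationalTateModule

end Literature.AlgebraicGeometry.Motives

/-! ## Frobenius on `E(k̄)`, `T_ℓ E` and `V_ℓ E`: density and closure -/

namespace WeierstrassCurve

open Literature.NumberTheory.EllipticCurves Literature.AlgebraicGeometry.Motives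

variable {k : Type u} [Field k] [Finite k] (W : WeierstrassCurve k)
  {σ : Field.absoluteGaloisGroup k} (ℓ : ℕ) [Fact ℓ.Prime]

omit [Fact ℓ.Prime] in
/-- Every `τ ∈ Γ_k` agrees with a power of Frobenius on the `n`-th component of a given element of
the Tate module: density of Frobenius on the coordinates of the geometric point `y_n` (the tree's
`Literature.AlgebraicGeometry.Motives.exists_frobenius_pow_apply_eq` and `geomPoints.exists_finset_smul_eq` of
`FaltingsECCardProofs`). Tate (1966), §1; Serre, *Local Fields*, XIII §1. [folklore] -/
theorem exists_proj_smul_eq_proj_frobenius_pow_smul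
    (hσ : ∀ x : AlgebraicClosure k, σ • x = x ^ Nat.card k) (τ : Field.absoluteGaloisGroup k)
    (y : W.tateModule ℓ) (n : ℕ) :
    ∃ m : ℕ, TateModule.proj ℓ n (τ • y) = TateModule.proj ℓ n ((σ ^ m) • y) := by
  obtain ⟨S, hS⟩ := geomPoints.exists_finset_smul_eq (TateModule.proj ℓ n y)
  obtain ⟨m, hm⟩ := Literature.AlgebraicGeometry.Motives.exists_frobenius_pow_apply_eq (K := k) (L := AlgebraicClosure k) τ
    (τ := σ) hσ (S := (S : Set (AlgebraicClosure k))) (Finset.finite_toSet _)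
  refine ⟨m, ?_⟩
  rw [TateModule.proj_smul_of_distribMulAction, TateModule.proj_smul_of_distribMulAction]
  exact hS τ (σ ^ m) (fun s hs ↦ hm s (Finset.mem_coe.mpr hs))

variable {W ℓ} in
/-- **Frobenius-stable sublattices of `T_ℓ E` are `Γ_k`-stable** (`k` finite, `E / k` elliptic,
`ℓ` any prime). If a `ℤ_ℓ`-submodule `L ⊆ T_ℓ E` is stable under the arithmetic Frobenius `σ_q`,
it is stable under every `τ ∈ Γ_k`: for each `n`, `τ` agrees with some `σ_q ^ m` on `y_n`, so
`τ y ≡ σ_q ^ m y ∈ L (mod ℓ^n T_ℓ E)`, and `L` is `ℓ`-adically closed in the finitely generated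
`ℤ_ℓ`-module `T_ℓ E` (Krull). This is the lattice form of "`Γ_k` is topologically generated by
Frobenius and acts continuously" (Tate (1966), §1; Serre (1968), I.1.1). [folklore] -/
theorem smul_mem_of_frobenius_smul_mem [W.IsElliptic]
    (hσ : ∀ x : AlgebraicClosure k, σ • x = x ^ Nat.card k) (L : Submodule ℤ_[ℓ] (W.tateModule ℓ))
    (hL : ∀ y ∈ L, σ • y ∈ L) (τ : Field.absoluteGaloisGroup k)
    {y : W.tateModule ℓ} (hy : y ∈ L) : τ • y ∈ L := by
  haveI : Module.Finite ℤ_[ℓ] (W.tateModule ℓ) := module_finite_tateModule_holds W ℓ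
  have hpow : ∀ (m : ℕ), ∀ z ∈ L, (σ ^ m) • z ∈ L := by
    intro m
    induction m with
    | zero => intro z hz; rwa [pow_zero, one_smul]
    | succ m ih => intro z hz; rw [pow_succ', mul_smul]; exact hL _ (ih z hz)
  refine mem_of_forall_exists_sub_mem_pow_smul_top L fun n ↦ ?_
  obtain ⟨m, hm⟩ := W.exists_proj_smul_eq_proj_frobenius_pow_smul ℓ hσ τ y n
  refine ⟨(σ ^ m) • y, hpow m y hy, ?_⟩
  exact TateModule.mem_pow_smul_top_of_proj_eq_zero (by rw [map_sub, hm, sub_self])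

variable {W ℓ} in
/-- **Frobenius-stable subspaces of `V_ℓ E` are `Γ_k`-stable** (`k` finite, `E / k` elliptic, `ℓ`
any prime): a `ℚ_ℓ`-subspace of `V_ℓ E` stable under `ρ(σ_q)` is stable under `ρ(τ)` for every
`τ ∈ Γ_k`. Reduced to the lattice statement `smul_mem_of_frobenius_smul_mem` for
`L = {x ∈ T_ℓ E | 1 ⊗ x ∈ Q}` by clearing denominators. Consequently the `Γ_k`-subrepresentations
of `V_ℓ E` are exactly the `σ_q`-stable subspaces (Tate (1966), §1). [folklore] -/
theorem rationalGaloisRepTate_mem_of_frobenius [W.IsElliptic]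
    (hσ : ∀ x : AlgebraicClosure k, σ • x = x ^ Nat.card k)
    (Q : Submodule ℚ_[ℓ] (W.rationalTateModule ℓ))
    (hQ : ∀ v ∈ Q, rationalGaloisRepTate W ℓ σ v ∈ Q)
    (τ : Field.absoluteGaloisGroup k) {v : W.rationalTateModule ℓ} (hv : v ∈ Q) :
    rationalGaloisRepTate W ℓ τ v ∈ Q := by
  -- the lattice `L = {x ∈ T_ℓ E | 1 ⊗ x ∈ Q}`
  let L : Submodule ℤ_[ℓ] (W.tateModule ℓ) :=
    (Q.restrictScalars ℤ_[ℓ]).comap (TateModule.toRational ℓ)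
  have hmemL : ∀ x, x ∈ L ↔ TateModule.toRational ℓ x ∈ Q := fun x ↦ Iff.rfl
  have hL : ∀ y ∈ L, σ • y ∈ L := fun y hy ↦ by
    rw [hmemL, ← rationalTateRepresentation_toRational]
    exact hQ _ ((hmemL y).mp hy)
  -- clear denominators: `N • v = 1 ⊗ x` with `x ∈ L`
  obtain ⟨N, hN, x, hx⟩ := RationalTateModule.exists_smul_eq_toRational v
  have hxL : x ∈ L := by
    rw [hmemL, ← hx]
    exact Q.smul_mem _ hv
  have hτx : TateModule.toRational ℓ (τ • x) ∈ Q :=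
    (hmemL _).mp (smul_mem_of_frobenius_smul_mem hσ L hL τ hxL)
  have hN' : (N : ℚ_[ℓ]) ≠ 0 := PadicInt.coe_ne_zero.mpr hN
  have hv' : v = (N : ℚ_[ℓ])⁻¹ • TateModule.toRational ℓ x := by
    rw [← hx, smul_smul, inv_mul_cancel₀ hN', one_smul]
  rw [hv', map_smul]
  refine Q.smul_mem _ ?_
  change rationalTateRepresentation _ _ ℓ τ (TateModule.toRational ℓ x) ∈ Q
  rwa [rationalTateRepresentation_toRational]

end WeierstrassCurve

namespace WeierstrassCurve

open Literature.NumberTheory.EllipticCurves Literature.AlgebraicGeometry.Motives Polynomial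

/-! ## The subring `ℤ[φ]` of `End_K(E)` generated by an isogeny: no zero divisors -/

section Domain

variable {K : Type u} [Field K] (W : WeierstrassCurve K)

/-- **`Hom_K(E, E)` has no zero divisors** (for `E` elliptic): if two elements of the `ℤ`-span of
the isogenies `E → E` over `K` compose to zero, one of them is zero. By "`Hom` is a group"
(`mem_homModule_iff_holds`, Silverman, *AEC*, III.§4) both are `0` or isogenies; a composite
`χ₁ ∘ χ₂ = 0` of isogenies would give `χ₂(E(K̄)) ⊆ ker χ₁` finite with `ker χ₂` finite, so `E(K̄)`
finite, which it is not. Silverman, *AEC*, Prop. III.4.2(c) (`End(E)` has no zero divisors),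
here for the subring `Hom_K(E, E)` realised on `K̄`-points.
[cite: SilvermanAEC2009, Prop. III.4.2(c)] -/
theorem eq_zero_or_eq_zero_of_comp_eq_zero [W.IsElliptic] {φ ψ : W.geomPoints →+ W.geomPoints}
    (hφ : φ ∈ homModule W W) (hψ : ψ ∈ homModule W W) (h : φ.comp ψ = 0) : φ = 0 ∨ ψ = 0 := by
  rcases (mem_homModule_iff_holds (W := W) (W' := W) φ).mp hφ with rfl | ⟨χ₁, rfl⟩
  · exact Or.inl rfl
  rcases (mem_homModule_iff_holds (W := W) (W' := W) ψ).mp hψ with rfl | ⟨χ₂, rfl⟩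
  · exact Or.inr rfl
  exfalso
  -- `range χ₂ ⊆ ker χ₁` is finite and `ker χ₂` is finite, so `E(K̄)` would be finite
  have hrange : (χ₂.toAddMonoidHom.range : Set W.geomPoints).Finite := by
    refine χ₁.finite_ker.subset ?_
    rintro _ ⟨P, rfl⟩
    exact (AddMonoidHom.mem_ker).mpr (DFunLike.congr_fun h P)
  haveI : Finite χ₂.toAddMonoidHom.range := hrange.to_subtype
  letI : Fintype χ₂.toAddMonoidHom.range := Fintype.ofFinite _
  letI : Fintype χ₂.toAddMonoidHom.rangeRestrict.ker := by
    rw [AddMonoidHom.ker_rangeRestrict]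
    exact Fintype.ofFinite _
  haveI : Finite W.geomPoints :=
    @Finite.of_fintype _ (AddGroup.fintypeOfKerOfCodom χ₂.toAddMonoidHom.rangeRestrict)
  exact not_finite W.geomPoints

end Domain

/-! ## `ℤ[φ]`: powers, polynomials, transport to `T_ℓ`, separability, semisimplicity

Throughout, an isogeny `φ : E → E` over `K` is read in the `K`-rational endomorphism ring
`End_K(E) = W.endRing` (a subring of `AddMonoid.End E(K̄)`) as the element
`⟨φ.toAddMonoidHom, φ.toAddMonoidHom_mem_endRing⟩`. -/

section EndAlgebra

variable {K : Type u} [Field K] (W : WeierstrassCurve K)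

namespace Isogeny

variable {W}

/-- **The powers `φ ^ n` of an endomorphism are isogenies** over `K`: iterate the tree's
composition of isogenies (`Isogeny.comp`, file `IsogenyCompProofs`) starting from the identity
isogeny (`Isogeny.id`, file `IsogenyIdProofs`). Silverman, *AEC*, III.§4 ("`End(E)` is a ring
under composition"). [folklore] -/
theorem exists_toAddMonoidHom_eq_pow (φ : Isogeny W W) (n : ℕ) :
    ∃ ψ : Isogeny W W, ψ.toAddMonoidHom =
      (((⟨φ.toAddMonoidHom, φ.toAddMonoidHom_mem_endRing⟩ : W.endRing) ^ n : W.endRing) :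
        AddMonoid.End W.geomPoints) := by
  induction n with
  | zero => exact ⟨Isogeny.id W, by rw [pow_zero]; rfl⟩
  | succ n ih =>
    obtain ⟨ψ, hψ⟩ := ih
    refine ⟨φ.comp ψ, ?_⟩
    rw [pow_succ', Subring.coe_mul, ← hψ]
    rfl

/-- Polynomials in an endomorphism `φ` with integer coefficients lie in `Hom_K(E, E)` (the
`ℤ`-span of the isogenies): `f(φ) = Σ fᵢ φⁱ` with `φⁱ` isogenies. [folklore] -/
theorem coe_aeval_mem_homModule (φ : Isogeny W W) (f : ℤ[X]) :
    ((Polynomial.aeval (⟨φ.toAddMonoidHom, φ.toAddMonoidHom_mem_endRing⟩ : W.endRing) f :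
      W.endRing) : AddMonoid.End W.geomPoints) ∈ homModule W W := by
  induction f using Polynomial.induction_on' with
  | add f g hf hg =>
    rw [map_add, Subring.coe_add]
    exact Submodule.add_mem _ hf hg
  | monomial n c =>
    obtain ⟨ψ, hψ⟩ := φ.exists_toAddMonoidHom_eq_pow n
    rw [Polynomial.aeval_monomial, Algebra.algebraMap_eq_smul_one, smul_mul_assoc, one_mul,
      AddSubgroupClass.coe_zsmul, ← hψ]
    exact Submodule.smul_mem _ c ψ.toAddMonoidHom_mem_homModule

/-- **The minimal polynomial of an endomorphism is separable.** If an isogeny `φ ∈ End_K(E)`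
(`E` elliptic) satisfies some non-zero integer polynomial, then it satisfies one whose image in
`ℚ[X]` is separable: a non-zero `g ∈ ℤ[X]` of least degree with `g(φ) = 0` is squarefree over
`ℚ`, because a factorisation `g = a · b` over `ℚ` into factors of smaller degree clears to
`a'(φ) ∘ b'(φ) = N g(φ) = 0` in `Hom_K(E, E)`, which has no zero divisors
(`eq_zero_or_eq_zero_of_comp_eq_zero`), contradicting minimality. For the Frobenius of a curve
over a finite field this is the elliptic-curve case of Tate's "`F = ℚ[π]` is semisimple" (here a
field, `End⁰(E)` being a division algebra: Silverman, *AEC*, III.§9). [folklore] -/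
theorem exists_aeval_eq_zero_separable [W.IsElliptic] (φ : Isogeny W W)
    (halg : ∃ f : ℤ[X], f ≠ 0 ∧
      Polynomial.aeval (⟨φ.toAddMonoidHom, φ.toAddMonoidHom_mem_endRing⟩ : W.endRing) f = 0) :
    ∃ g : ℤ[X],
      Polynomial.aeval (⟨φ.toAddMonoidHom, φ.toAddMonoidHom_mem_endRing⟩ : W.endRing) g = 0 ∧
        (g.map (Int.castRingHom ℚ)).Separable := by
  classical
  set π : W.endRing := ⟨φ.toAddMonoidHom, φ.toAddMonoidHom_mem_endRing⟩ with hπ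
  -- a relation of least degree
  have hex : ∃ d : ℕ, ∃ f : ℤ[X], f ≠ 0 ∧ Polynomial.aeval π f = 0 ∧ f.natDegree = d := by
    obtain ⟨f, hf0, hf⟩ := halg
    exact ⟨_, f, hf0, hf, rfl⟩
  obtain ⟨g, hg0, hg, hgd⟩ := Nat.find_spec hex
  have hmin : ∀ f : ℤ[X], f ≠ 0 → Polynomial.aeval π f = 0 →
      g.natDegree ≤ f.natDegree := fun f hf0 hf ↦
    hgd ▸ Nat.find_min' hex ⟨f, hf0, hf, rfl⟩
  refine ⟨g, hg, ?_⟩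
  have hinj : Function.Injective (Int.castRingHom ℚ) := RingHom.injective_int _
  set gq : ℚ[X] := g.map (Int.castRingHom ℚ) with hgq
  have hgq0 : gq ≠ 0 := (Polynomial.map_ne_zero_iff hinj).mpr hg0
  have hdeg_gq : gq.natDegree = g.natDegree := Polynomial.natDegree_map_eq_of_injective hinj g
  -- key step: no factorisation of `gq` into two factors of smaller degree
  have key : ∀ a b : ℚ[X], gq = a * b → a.natDegree < g.natDegree → b.natDegree < g.natDegree →
      False := by
    intro a b hab ha hb
    have ha0 : a ≠ 0 := left_ne_zero_of_mul (hab ▸ hgq0)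
    have hb0 : b ≠ 0 := right_ne_zero_of_mul (hab ▸ hgq0)
    -- clear denominators
    obtain ⟨Na, hNa, ha'⟩ := IsLocalization.integerNormalization_spec (nonZeroDivisors ℤ) a
    obtain ⟨Nb, hNb, hb'⟩ := IsLocalization.integerNormalization_spec (nonZeroDivisors ℤ) b
    set a' : ℤ[X] := IsLocalization.integerNormalization (nonZeroDivisors ℤ) a
    set b' : ℤ[X] := IsLocalization.integerNormalization (nonZeroDivisors ℤ) b
    have hNa0 : Na ≠ 0 := nonZeroDivisors.ne_zero hNa
    have hNb0 : Nb ≠ 0 := nonZeroDivisors.ne_zero hNb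
    have hsmul : ∀ (N : ℤ) (q : ℚ[X]), N • q = Polynomial.C (N : ℚ) * q := fun N q ↦ by
      rw [← algebraMap_smul ℚ N q, Polynomial.smul_eq_C_mul, eq_intCast]
    change a'.map (algebraMap ℤ ℚ) = Na • a at ha'
    change b'.map (algebraMap ℤ ℚ) = Nb • b at hb'
    have ha'q : a'.map (Int.castRingHom ℚ) = Polynomial.C (Na : ℚ) * a := by
      rw [← hsmul]; exact ha'
    have hb'q : b'.map (Int.castRingHom ℚ) = Polynomial.C (Nb : ℚ) * b := by
      rw [← hsmul]; exact hb'
    -- `a' * b' = (Na * Nb) • g`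
    have hab' : a' * b' = Polynomial.C (Na * Nb) * g := by
      apply Polynomial.map_injective (Int.castRingHom ℚ) hinj
      rw [Polynomial.map_mul, ha'q, hb'q, Polynomial.map_mul, Polynomial.map_C, ← hgq, hab]
      simp only [map_mul, eq_intCast]
      ring
    -- degrees and non-vanishing
    have hdeg_a' : a'.natDegree = a.natDegree := by
      rw [← Polynomial.natDegree_map_eq_of_injective hinj a', ha'q, Polynomial.natDegree_C_mul]
      exact_mod_cast hNa0
    have hdeg_b' : b'.natDegree = b.natDegree := by
      rw [← Polynomial.natDegree_map_eq_of_injective hinj b', hb'q, Polynomial.natDegree_C_mul]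
      exact_mod_cast hNb0
    have ha'0 : a' ≠ 0 := by
      intro h0
      have : a'.map (Int.castRingHom ℚ) = 0 := by rw [h0, Polynomial.map_zero]
      rw [ha'q, mul_eq_zero, Polynomial.C_eq_zero, Int.cast_eq_zero] at this
      exact this.elim hNa0 ha0
    have hb'0 : b' ≠ 0 := by
      intro h0
      have : b'.map (Int.castRingHom ℚ) = 0 := by rw [h0, Polynomial.map_zero]
      rw [hb'q, mul_eq_zero, Polynomial.C_eq_zero, Int.cast_eq_zero] at this
      exact this.elim hNb0 hb0
    -- `a'(φ) ∘ b'(φ) = (Na Nb) g(φ) = 0`, so one factor kills `φ`: contradiction with minimality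
    have hprod : Polynomial.aeval π a' * Polynomial.aeval π b' = 0 := by
      rw [← map_mul, hab', map_mul, hg, mul_zero]
    have hprod' : ((Polynomial.aeval π a' : W.endRing) : AddMonoid.End W.geomPoints).comp
        ((Polynomial.aeval π b' : W.endRing) : AddMonoid.End W.geomPoints) = 0 := by
      have := congr_arg Subtype.val hprod
      rwa [Subring.coe_mul] at this
    rcases W.eq_zero_or_eq_zero_of_comp_eq_zero (φ.coe_aeval_mem_homModule a')
      (φ.coe_aeval_mem_homModule b') hprod' with h1 | h1
    · have h1' : Polynomial.aeval π a' = 0 := Subtype.ext h1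
      exact (Nat.lt_irrefl _) ((hmin a' ha'0 h1').trans_lt (hdeg_a' ▸ ha))
    · have h1' : Polynomial.aeval π b' = 0 := Subtype.ext h1
      exact (Nat.lt_irrefl _) ((hmin b' hb'0 h1').trans_lt (hdeg_b' ▸ hb))
  -- squarefree over the perfect field `ℚ`, hence separable
  refine PerfectField.separable_iff_squarefree.mpr fun d hd ↦ ?_
  by_contra hdu
  obtain ⟨e, he⟩ := hd
  have hd0 : d ≠ 0 := by
    rintro rfl
    exact hgq0 (by rw [he, zero_mul, zero_mul])
  have he0 : e ≠ 0 := by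
    rintro rfl
    exact hgq0 (by rw [he, mul_zero])
  have hdpos : 0 < d.natDegree :=
    Polynomial.natDegree_pos_iff_degree_pos.mpr
      (Polynomial.degree_pos_of_ne_zero_of_nonunit hd0 hdu)
  have hdeg : gq.natDegree = d.natDegree + (d.natDegree + e.natDegree) := by
    rw [he, mul_assoc, Polynomial.natDegree_mul hd0 (mul_ne_zero hd0 he0),
      Polynomial.natDegree_mul hd0 he0]
  refine key d (d * e) (by rw [he, mul_assoc]) ?_ ?_
  · omega
  · rw [Polynomial.natDegree_mul hd0 he0]
    omega

variable (ℓ : ℕ) [Fact ℓ.Prime]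

/-- A polynomial relation `f(π) = 0` in `End_K(E)` persists on the rational Tate module:
`f(V_ℓ(π)) = 0` in `End_{ℚ_ℓ}(V_ℓ E)` for `V_ℓ(π) = ℚ_ℓ ⊗ T_ℓ(π)` (hypothesis `hT`; `T_ℓ` is the
ring homomorphism `Literature.AlgebraicGeometry.Motives.tateEndRingHom`, and base change `End_{ℤ_ℓ}(T_ℓ E) → End_{ℚ_ℓ}(V_ℓ E)`
is a ring homomorphism, Mathlib `Module.End.baseChangeHom`; the two structure maps
`ℤ → End_{ℚ_ℓ}(V_ℓ E)` agree as `ℤ` is initial). [folklore] -/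
theorem _root_.WeierstrassCurve.aeval_eq_zero_of_eq_baseChange_tateEndRingHom (π : W.endRing)
    {f : ℤ[X]} (hf : Polynomial.aeval π f = 0) {T : Module.End ℚ_[ℓ] (W.rationalTateModule ℓ)}
    (hT : T = (Literature.AlgebraicGeometry.Motives.tateEndRingHom W ℓ π).baseChange ℚ_[ℓ]) :
    Polynomial.aeval T (f.map (algebraMap ℤ ℚ_[ℓ])) = 0 := by
  -- the ring homomorphism `V_ℓ : End_K(E) → End_{ℚ_ℓ}(V_ℓ E)`
  let G : W.endRing →+* Module.End ℚ_[ℓ] (W.rationalTateModule ℓ) :=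
    (show Module.End ℤ_[ℓ] (W.tateModule ℓ) →+* Module.End ℚ_[ℓ] (W.rationalTateModule ℓ) from
      (Module.End.baseChangeHom ℤ_[ℓ] ℚ_[ℓ] (W.tateModule ℓ)).toRingHom).comp
      (Literature.AlgebraicGeometry.Motives.tateEndRingHom W ℓ)
  have hG : G π = T := by rw [hT]; rfl
  have e1 : Polynomial.aeval T (f.map (algebraMap ℤ ℚ_[ℓ])) =
      f.eval₂ ((algebraMap ℚ_[ℓ] (Module.End ℚ_[ℓ] (W.rationalTateModule ℓ))).comp
        (algebraMap ℤ ℚ_[ℓ])) (G π) := by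
    rw [Polynomial.aeval_def, Polynomial.eval₂_map, hG]
  have e2 : G (Polynomial.aeval π f) = f.eval₂ (G.comp (algebraMap ℤ W.endRing)) (G π) := by
    rw [Polynomial.aeval_def, Polynomial.hom_eval₂]
  rw [e1, Subsingleton.elim ((algebraMap ℚ_[ℓ] (Module.End ℚ_[ℓ] (W.rationalTateModule ℓ))).comp
    (algebraMap ℤ ℚ_[ℓ])) (G.comp (algebraMap ℤ W.endRing)), ← e2, hf, map_zero]

/-- **An endomorphism algebraic over `ℤ` acts semisimply on `V_ℓ E`** (every prime `ℓ`): for an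
isogeny `φ ∈ End_K(E)` (`E` elliptic) satisfying a non-zero integer polynomial,
`V_ℓ(φ) = ℚ_ℓ ⊗ T_ℓ(φ)` (hypothesis `hT`) is a semisimple endomorphism of `V_ℓ E` — the separable
polynomial of `exists_aeval_eq_zero_separable` kills `V_ℓ(φ)`, and an endomorphism of a vector
space killed by a squarefree polynomial is semisimple (Mathlib
`Module.End.isSemisimple_of_squarefree_aeval_eq_zero`). For the Frobenius this is Tate's
"`F ⊗ ℚ_ℓ` is semisimple, hence `π` acts semisimply on `V_ℓ`" (Tate (1966), §1–2). [folklore] -/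
theorem isSemisimple_of_eq_baseChange_tateEndRingHom [W.IsElliptic] (φ : Isogeny W W)
    (halg : ∃ f : ℤ[X], f ≠ 0 ∧
      Polynomial.aeval (⟨φ.toAddMonoidHom, φ.toAddMonoidHom_mem_endRing⟩ : W.endRing) f = 0)
    {T : Module.End ℚ_[ℓ] (W.rationalTateModule ℓ)}
    (hT : T = (Literature.AlgebraicGeometry.Motives.tateEndRingHom W ℓ
      ⟨φ.toAddMonoidHom, φ.toAddMonoidHom_mem_endRing⟩).baseChange ℚ_[ℓ]) :
    Module.End.IsSemisimple T := by
  obtain ⟨g, hg, hsep⟩ := φ.exists_aeval_eq_zero_separable halg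
  refine Module.End.isSemisimple_of_squarefree_aeval_eq_zero (p := g.map (algebraMap ℤ ℚ_[ℓ]))
    ?_ (W.aeval_eq_zero_of_eq_baseChange_tateEndRingHom ℓ _ hg hT)
  have hmap : g.map (algebraMap ℤ ℚ_[ℓ]) =
      (g.map (Int.castRingHom ℚ)).map (algebraMap ℚ ℚ_[ℓ]) := by
    rw [Polynomial.map_map]
    congr 1
  rw [hmap]
  exact hsep.map.squarefree

/-- **Transfer from `T_ℓ₀` to `End(E)`.** For `E / K` elliptic, `ℓ₀ ≠ char K`, an isogeny
`φ ∈ End_K(E)` and `g ∈ ℤ[X]`: if `g(T_{ℓ₀} φ) = 0` on `T_{ℓ₀} E`, then `g(φ) = 0` in `End_K(E)`.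
Indeed `ψ = g(φ)` lies in `Hom_K(E, E)`, so it is `0` or an isogeny ("`Hom` is a group",
`mem_homModule_iff_holds`); its Tate-module map is `g(T_{ℓ₀} φ) = 0`, so `ψ` kills every
`E[ℓ₀ⁿ]` (each `ℓ₀ⁿ`-torsion point is the `n`-th component of an element of `T_{ℓ₀} E`,
`Literature.AlgebraicGeometry.Motives.exists_proj_tateModule_eq`), a family of subgroups of unbounded order `ℓ₀^{2n}`
(`#E[m] = m²`, proved in the tree) — impossible for an isogeny, whose kernel is finite.
(Silverman, *AEC*, V.§2, proof of Thm. V.2.3.1(b), derives `φ² - aφ + q = 0` in `End(E)` from the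
same identity on `T_ℓ E` using `deg = det` instead.) [folklore] -/
theorem aeval_eq_zero_of_aeval_tateEndRingHom_eq_zero [W.IsElliptic] (φ : Isogeny W W)
    {ℓ₀ : ℕ} [Fact ℓ₀.Prime] (hℓ₀ : (ℓ₀ : K) ≠ 0) {g : ℤ[X]}
    (hg : Polynomial.aeval (Literature.AlgebraicGeometry.Motives.tateEndRingHom W ℓ₀
      ⟨φ.toAddMonoidHom, φ.toAddMonoidHom_mem_endRing⟩) g = 0) :
    Polynomial.aeval (⟨φ.toAddMonoidHom, φ.toAddMonoidHom_mem_endRing⟩ : W.endRing) g = 0 := by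
  set π : W.endRing := ⟨φ.toAddMonoidHom, φ.toAddMonoidHom_mem_endRing⟩ with hπ
  set ψ : W.endRing := Polynomial.aeval π g with hψ
  -- `T_ℓ₀(ψ) = g(T_ℓ₀ φ) = 0`
  have hT : Literature.AlgebraicGeometry.Motives.tateEndRingHom W ℓ₀ ψ = 0 := by
    rw [hψ, show Literature.AlgebraicGeometry.Motives.tateEndRingHom W ℓ₀ (Polynomial.aeval π g) =
        (Literature.AlgebraicGeometry.Motives.tateEndRingHom W ℓ₀).toIntAlgHom (Polynomial.aeval π g) from rfl,
      ← Polynomial.aeval_algHom_apply]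
    exact hg
  -- hence `ψ` kills every `ℓ₀`-power torsion point
  have hker : ∀ (n : ℕ) (P : W.geomPoints), P ∈ geomTorsion W (ℓ₀ ^ n : ℕ) →
      (ψ : AddMonoid.End W.geomPoints) P = 0 := by
    intro n P hP
    obtain ⟨x, rfl⟩ := Literature.AlgebraicGeometry.Motives.exists_proj_tateModule_eq ℓ₀ n hP
    have := congr_arg
      (fun F : Module.End ℤ_[ℓ₀] (W.tateModule ℓ₀) ↦ TateModule.proj ℓ₀ n (F x)) hT
    simp only [Literature.AlgebraicGeometry.Motives.tateEndRingHom_apply, TateModule.proj_map, LinearMap.zero_apply,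
      map_zero] at this
    exact this
  -- `ψ ∈ Hom_K(E, E)` is `0` or an isogeny; an isogeny has finite kernel, but `#E[ℓ₀ⁿ] = ℓ₀^{2n}`
  have hmem : ((ψ : AddMonoid.End W.geomPoints) : W.geomPoints →+ W.geomPoints) ∈
      homModule W W :=
    φ.coe_aeval_mem_homModule g
  rcases (mem_homModule_iff_holds (W := W) (W' := W) _).mp hmem with h0 | ⟨χ, hχ⟩
  · exact Subtype.ext h0
  · exfalso
    haveI : Finite χ.toAddMonoidHom.ker := χ.finite_ker.to_subtype
    -- `E[ℓ₀ⁿ] ≤ ker χ` for all `n`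
    have hle : ∀ n : ℕ, geomTorsion W (ℓ₀ ^ n : ℕ) ≤ χ.toAddMonoidHom.ker := fun n P hP ↦ by
      rw [AddMonoidHom.mem_ker, hχ]
      exact hker n P hP
    have hcard : ∀ n : ℕ, ℓ₀ ^ (2 * n) ≤ Nat.card χ.toAddMonoidHom.ker := fun n ↦ by
      rw [← card_geomTorsion_pow_eq W ℓ₀ (card_torsionPoints_eq_sq_holds W (AlgebraicClosure K))
        hℓ₀ n]
      exact AddSubgroup.card_le_of_le (hle n)
    have hlt : Nat.card χ.toAddMonoidHom.ker < ℓ₀ ^ (2 * Nat.card χ.toAddMonoidHom.ker) :=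
      calc Nat.card χ.toAddMonoidHom.ker
          < 2 ^ Nat.card χ.toAddMonoidHom.ker := Nat.lt_two_pow_self
        _ ≤ ℓ₀ ^ Nat.card χ.toAddMonoidHom.ker :=
          Nat.pow_le_pow_left (Fact.out : ℓ₀.Prime).two_le _
        _ ≤ ℓ₀ ^ (2 * Nat.card χ.toAddMonoidHom.ker) :=
          Nat.pow_le_pow_right (Fact.out : ℓ₀.Prime).pos (by omega)
    exact (Nat.lt_irrefl _) ((hcard _).trans_lt hlt)

/-- **An endomorphism is algebraic over `ℤ`, from Silverman III.7.4.** For `E / K` elliptic, an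
isogeny `φ ∈ End_K(E)` and a prime `ℓ₀ ≠ char K` at which the injectivity statement
`Literature.Hodge.linearIndependent_tateModule_map ℓ₀` (Silverman, *AEC*, Thm. III.7.4) holds, `φ`
satisfies a non-trivial integer polynomial: otherwise `1, φ, …, φ⁴` would be `ℤ`-independent
isogenies, hence have `ℤ_{ℓ₀}`-independent images in `End_{ℤ_{ℓ₀}}(T_{ℓ₀} E) ≅ M₂(ℤ_{ℓ₀})`, a free
module of rank `4` (`T_{ℓ₀} E ≅ ℤ_{ℓ₀}²`, Silverman III.7.1, proved in the tree). This is the rank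
bound `rk End_K(E) ≤ 4` of Silverman, *AEC*, Cor. III.7.5, in the form needed here; Tate (1966),
§1 uses the finite generation of `End_k(A)` in the same way.
[cite: SilvermanAEC2009, Cor. III.7.5 (from Thm. III.7.4)] -/
theorem exists_aeval_eq_zero_of_linearIndependent [W.IsElliptic] (φ : Isogeny W W)
    {ℓ₀ : ℕ} [Fact ℓ₀.Prime] (hℓ₀ : (ℓ₀ : K) ≠ 0)
    (h : Literature.AlgebraicGeometry.Motives.linearIndependent_tateModule_map.{u, 0} (W := W) (W' := W) ℓ₀) :
    ∃ f : ℤ[X], f ≠ 0 ∧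
      Polynomial.aeval (⟨φ.toAddMonoidHom, φ.toAddMonoidHom_mem_endRing⟩ : W.endRing) f = 0 := by
  set π : W.endRing := ⟨φ.toAddMonoidHom, φ.toAddMonoidHom_mem_endRing⟩ with hπ
  by_contra hcon
  push Not at hcon
  -- the isogenies `φ⁰, …, φ⁴`
  choose ψ hψ using fun i : Fin 5 ↦ φ.exists_toAddMonoidHom_eq_pow (i : ℕ)
  -- they are `ℤ`-linearly independent
  have hind : LinearIndependent ℤ fun i : Fin 5 ↦ (ψ i).toAddMonoidHom := by
    rw [Fintype.linearIndependent_iff]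
    intro c hc i
    set f : ℤ[X] := ∑ j : Fin 5, Polynomial.monomial (j : ℕ) (c j) with hfdef
    have hf : Polynomial.aeval π f = 0 := by
      apply Subtype.ext
      have e : ((Polynomial.aeval π f : W.endRing) : AddMonoid.End W.geomPoints) =
          ∑ j : Fin 5, c j • ((ψ j).toAddMonoidHom : AddMonoid.End W.geomPoints) := by
        rw [hfdef, map_sum, AddSubmonoidClass.coe_finsetSum]
        refine Finset.sum_congr rfl fun j _ ↦ ?_
        rw [Polynomial.aeval_monomial, Algebra.algebraMap_eq_smul_one, smul_mul_assoc, one_mul,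
          AddSubgroupClass.coe_zsmul, hψ j]
        rfl
      rw [e]
      exact hc
    have hf0 : f = 0 := by
      by_contra hne
      exact hcon f hne hf
    have := congr_arg (fun g : ℤ[X] ↦ g.coeff i) hf0
    simp only [hfdef, Polynomial.finsetSum_coeff, Polynomial.coeff_monomial, Polynomial.coeff_zero,
      Fin.val_eq_val, Finset.sum_ite_eq', Finset.mem_univ, if_true] at this
    exact this
  -- their Tate-module images are `ℤ_ℓ₀`-independent in a free module of rank `4`
  have hT := h hℓ₀ ψ hind
  haveI : Module.Free ℤ_[ℓ₀] (W.tateModule ℓ₀) := module_free_tateModule_holds W ℓ₀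
  haveI : Module.Finite ℤ_[ℓ₀] (W.tateModule ℓ₀) := module_finite_tateModule_holds W ℓ₀
  have hrank : Module.finrank ℤ_[ℓ₀] (W.tateModule ℓ₀ →ₗ[ℤ_[ℓ₀]] W.tateModule ℓ₀) = 4 := by
    rw [Module.finrank_linearMap, finrank_tateModule_eq_two_holds W ℓ₀ hℓ₀]
  have h5 := hT.fintype_card_le_finrank
  rw [Fintype.card_fin, hrank] at h5
  omega

end Isogeny

/-! ## Cayley–Hamilton on the rank-two lattice `T_ℓ₀ E` -/

/-- **Cayley–Hamilton on `T_ℓ₀ E`.** For `E / K` elliptic and `ℓ₀ ≠ char K`, an endomorphism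
`F` of the free rank-two `ℤ_{ℓ₀}`-module `T_{ℓ₀} E` (Silverman III.7.1, proved in the tree)
satisfies `F² - tr(F) F + det(F) = 0` (Mathlib `LinearMap.aeval_self_charpoly`,
`Matrix.charpoly_fin_two`). Silverman, *AEC*, V.§2, proof of Thm. V.2.3.1 ("the Cayley–Hamilton
theorem tells us that `φ_ℓ` satisfies its characteristic polynomial"). [folklore] -/
theorem aeval_charpoly_tateModule_eq_zero [W.IsElliptic] {ℓ₀ : ℕ} [Fact ℓ₀.Prime]
    (hℓ₀ : (ℓ₀ : K) ≠ 0) (F : W.tateModule ℓ₀ →ₗ[ℤ_[ℓ₀]] W.tateModule ℓ₀) :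
    Polynomial.aeval F
      (X ^ 2 - C (LinearMap.trace ℤ_[ℓ₀] _ F) * X + C (LinearMap.det F) : ℤ_[ℓ₀][X]) = 0 := by
  haveI := module_free_tateModule_holds W ℓ₀
  haveI := module_finite_tateModule_holds W ℓ₀
  let b := Module.finBasisOfFinrankEq ℤ_[ℓ₀] (W.tateModule ℓ₀)
    (finrank_tateModule_eq_two_holds W ℓ₀ hℓ₀)
  have hch : F.charpoly = X ^ 2 - C (LinearMap.trace ℤ_[ℓ₀] _ F) * X + C (LinearMap.det F) := by
    rw [← LinearMap.charpoly_toMatrix F b, Matrix.charpoly_fin_two,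
      ← LinearMap.trace_eq_matrix_trace ℤ_[ℓ₀] b F, LinearMap.det_toMatrix b]
  rw [← hch]
  exact LinearMap.aeval_self_charpoly F

end EndAlgebra

/-! ## The Frobenius endomorphism over a finite field -/

section Frobenius

/- No hypothesis `[Finite k]` is needed in this section: the Frobenius is any `σ ∈ Γ_k` with
`σ x = x ^ Nat.card k` (for `k` infinite, `Nat.card k = 0` and no such `σ` exists). -/
variable {k : Type u} [Field k] (W : WeierstrassCurve k)
  {σ : Field.absoluteGaloisGroup k} (ℓ : ℕ) [Fact ℓ.Prime]

/-- **`ρ_ℓ(σ_q) = T_ℓ(π)`**: the `ℓ`-adic Galois representation at the arithmetic Frobenius is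
the image of the Frobenius endomorphism `π ∈ End_k(E)` under the ring homomorphism
`Literature.AlgebraicGeometry.Motives.tateEndRingHom` (the tree's `tateModule_map_frobeniusIsogeny`, rephrased).
Tate (1966), §1, (1); Silverman, *AEC*, V.§2. [folklore] -/
theorem tateEndRingHom_frobenius (hσ : ∀ x : AlgebraicClosure k, σ • x = x ^ Nat.card k) :
    Literature.AlgebraicGeometry.Motives.tateEndRingHom W ℓ ⟨(W.frobeniusIsogeny hσ).toAddMonoidHom,
      (W.frobeniusIsogeny hσ).toAddMonoidHom_mem_endRing⟩ = W.galoisRepTate ℓ σ := by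
  rw [Literature.AlgebraicGeometry.Motives.tateEndRingHom_apply]
  exact tateModule_map_frobeniusIsogeny W hσ ℓ

/-- The rational representation is the base change of the integral one:
`ρ_{V_ℓ}(τ) = ℚ_ℓ ⊗ ρ_ℓ(τ)` (by definition). [folklore] -/
theorem rationalGaloisRepTate_apply (τ : Field.absoluteGaloisGroup k) :
    rationalGaloisRepTate W ℓ τ = (galoisRepTate W ℓ τ).baseChange ℚ_[ℓ] :=
  rfl

/-- **`π` acts semisimply on `V_ℓ E`** (every prime `ℓ`), given that the Frobenius endomorphism
`π` is algebraic over `ℤ` (`Isogeny.isSemisimple_of_eq_baseChange_tateEndRingHom` for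
`φ = frobeniusIsogeny W hσ`, and `V_ℓ(π) = ρ_{V_ℓ}(σ_q)`). Tate (1966), §1–2. [folklore] -/
theorem isSemisimple_rationalGaloisRepTate_frobenius [W.IsElliptic]
    (hσ : ∀ x : AlgebraicClosure k, σ • x = x ^ Nat.card k)
    (halg : ∃ f : ℤ[X], f ≠ 0 ∧
      Polynomial.aeval (⟨(W.frobeniusIsogeny hσ).toAddMonoidHom,
        (W.frobeniusIsogeny hσ).toAddMonoidHom_mem_endRing⟩ : W.endRing) f = 0) :
    Module.End.IsSemisimple (rationalGaloisRepTate W ℓ σ) :=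
  (W.frobeniusIsogeny hσ).isSemisimple_of_eq_baseChange_tateEndRingHom ℓ halg
    (by rw [rationalGaloisRepTate_apply, tateEndRingHom_frobenius W ℓ hσ])

/-- **`π² - aπ + q = 0` in `End(E)` from the trace and determinant of Frobenius** (Silverman,
*AEC*, Thm. V.2.3.1(b), `a = q + 1 - #E(k)`): if at one prime `ℓ₀ ≠ char k` the Frobenius
`φ_{ℓ₀} = ρ_{ℓ₀}(σ_q)` on `T_{ℓ₀} E` has `det = q` and `tr = q + 1 - #E(k)`, then `π² - aπ + q = 0`
in `End_k(E)` (Cayley–Hamilton on `T_{ℓ₀} E`, `aeval_charpoly_tateModule_eq_zero`, and the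
transfer principle `Isogeny.aeval_eq_zero_of_aeval_tateEndRingHom_eq_zero`). In particular `π` is
algebraic over `ℤ`. [cite: SilvermanAEC2009, Thm. V.2.3.1(b)] -/
theorem aeval_frobenius_eq_zero_of_trace_det [W.IsElliptic]
    (hσ : ∀ x : AlgebraicClosure k, σ • x = x ^ Nat.card k) {ℓ₀ : ℕ} [Fact ℓ₀.Prime]
    (hℓ₀ : (ℓ₀ : k) ≠ 0)
    (hdet : LinearMap.det (W.galoisRepTate ℓ₀ σ : W.tateModule ℓ₀ →ₗ[ℤ_[ℓ₀]] W.tateModule ℓ₀) =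
      (Nat.card k : ℤ_[ℓ₀]))
    (htr : LinearMap.trace ℤ_[ℓ₀] (W.tateModule ℓ₀) (W.galoisRepTate ℓ₀ σ) =
      (Nat.card k : ℤ_[ℓ₀]) + 1 - (Nat.card W.toAffine.Point : ℤ_[ℓ₀])) :
    Polynomial.aeval (⟨(W.frobeniusIsogeny hσ).toAddMonoidHom,
        (W.frobeniusIsogeny hσ).toAddMonoidHom_mem_endRing⟩ : W.endRing)
      (X ^ 2 - C ((Nat.card k : ℤ) + 1 - Nat.card W.toAffine.Point) * X + C (Nat.card k : ℤ)) =
        0 := by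
  refine (W.frobeniusIsogeny hσ).aeval_eq_zero_of_aeval_tateEndRingHom_eq_zero hℓ₀ ?_
  rw [tateEndRingHom_frobenius W ℓ₀ hσ]
  have hch := W.aeval_charpoly_tateModule_eq_zero hℓ₀ (W.galoisRepTate ℓ₀ σ)
  rw [hdet, htr] at hch
  have hpoly : (X ^ 2 - C ((Nat.card k : ℤ) + 1 - Nat.card W.toAffine.Point) * X +
      C (Nat.card k : ℤ) : ℤ[X]).map (algebraMap ℤ ℤ_[ℓ₀]) =
      X ^ 2 - C ((Nat.card k : ℤ_[ℓ₀]) + 1 - (Nat.card W.toAffine.Point : ℤ_[ℓ₀])) * X +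
        C (Nat.card k : ℤ_[ℓ₀]) := by
    rw [Polynomial.map_add, Polynomial.map_sub, Polynomial.map_mul, Polynomial.map_pow,
      Polynomial.map_X, Polynomial.map_C, Polynomial.map_C, map_sub (algebraMap ℤ ℤ_[ℓ₀]),
      map_add (algebraMap ℤ ℤ_[ℓ₀]), map_one, map_natCast, map_natCast]
  rw [← Polynomial.aeval_map_algebraMap ℤ_[ℓ₀], hpoly]
  exact hch

/-- The integer polynomial `X² - aX + q` of Thm. V.2.3.1 is non-zero (it is monic). [folklore] -/
theorem X_sq_sub_C_mul_X_add_C_ne_zero (a q : ℤ) : (X ^ 2 - C a * X + C q : ℤ[X]) ≠ 0 :=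
  Polynomial.Monic.ne_zero (by monicity!)

end Frobenius

end WeierstrassCurve

/-! ## Assembly: Tate's semisimplicity theorem -/

namespace Literature.AlgebraicGeometry.Motives

open WeierstrassCurve Polynomial

variable {K : Type u} [Field K] (W : WeierstrassCurve K) (ℓ : ℕ) [Fact ℓ.Prime]

/-- **Semisimplicity of `V_ℓ E` from semisimplicity of Frobenius.** For `E` elliptic over a finite
field `k`, an arithmetic Frobenius `σ_q ∈ Γ_k` and any prime `ℓ`: if `ρ_{V_ℓ}(σ_q)` is a
semisimple endomorphism of `V_ℓ E`, then `V_ℓ E` is a semisimple representation of `Γ_k`. A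
subrepresentation `U` is `σ_q`-stable, so it has a `σ_q`-stable complement `Q` (Mathlib
`Module.End.isSemisimple_iff`), and `Q` is `Γ_k`-stable by `rationalGaloisRepTate_mem_of_frobenius`
(density of Frobenius + Krull). Tate (1966), §1. [folklore] -/
theorem isSemisimpleRepresentation_of_isSemisimple_frobenius [Finite K] [W.IsElliptic]
    {σ : Field.absoluteGaloisGroup K} (hσ : ∀ x : AlgebraicClosure K, σ • x = x ^ Nat.card K)
    (hF : Module.End.IsSemisimple (rationalGaloisRepTate W ℓ σ)) :
    (W.rationalGaloisRepTate ℓ).IsSemisimpleRepresentation := by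
  refine ⟨fun U ↦ ?_⟩
  obtain ⟨Q, hQ, hUQ⟩ := Module.End.isSemisimple_iff.mp hF U.toSubmodule
    (fun v hv ↦ U.apply_mem_toSubmodule σ hv)
  let U' : Subrepresentation (W.rationalGaloisRepTate ℓ) :=
    ⟨Q, fun τ v hv ↦ rationalGaloisRepTate_mem_of_frobenius hσ Q (fun w hw ↦ hQ hw) τ hv⟩
  refine ⟨U', ?_, ?_⟩
  · rw [disjoint_iff]
    apply Subrepresentation.toSubmodule_injective
    rw [Subrepresentation.toSubmodule_inf]
    exact disjoint_iff.mp hUQ.disjoint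
  · rw [codisjoint_iff]
    apply Subrepresentation.toSubmodule_injective
    rw [Subrepresentation.toSubmodule_sup]
    exact codisjoint_iff.mp hUQ.codisjoint

/-- **Tate's semisimplicity theorem, `ℓ`-adic part** (Tate (1966), §1–2, for `A = E` elliptic):
if the Frobenius endomorphism `π` of `E / k` satisfies a non-zero integer polynomial (i.e. is
algebraic over `ℤ` — the one geometric input, true because `End_k(E)` has finite rank), then
`V_ℓ E` is a semisimple `ℚ_ℓ[Γ_k]`-module for every prime `ℓ`: `ℤ[π]` has no zero divisors, so the
minimal relation is separable and `ρ(σ_q) = V_ℓ(π)` is semisimple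
(`isSemisimple_rationalGaloisRepTate_frobenius`), and `Γ_k`-semisimplicity follows by density and
closure (`isSemisimpleRepresentation_of_isSemisimple_frobenius`).
[cite: Tate1966Endomorphisms, §1–2 (Main Theorem; π acts semisimply on V_ℓ)] -/
theorem isSemisimpleRepresentation_rationalGaloisRepTate_of_exists_aeval_eq_zero [Finite K]
    [W.IsElliptic] {σ : Field.absoluteGaloisGroup K}
    (hσ : ∀ x : AlgebraicClosure K, σ • x = x ^ Nat.card K)
    (halg : ∃ f : ℤ[X], f ≠ 0 ∧
      Polynomial.aeval (⟨(W.frobeniusIsogeny hσ).toAddMonoidHom,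
        (W.frobeniusIsogeny hσ).toAddMonoidHom_mem_endRing⟩ : W.endRing) f = 0) :
    (W.rationalGaloisRepTate ℓ).IsSemisimpleRepresentation :=
  isSemisimpleRepresentation_of_isSemisimple_frobenius W ℓ hσ
    (W.isSemisimple_rationalGaloisRepTate_frobenius ℓ hσ halg)

/-- **Tate's semisimplicity theorem for elliptic curves, from Silverman III.7.4.** For Weierstrass
curves over a field `K` and primes `ℓ`, `ℓ₀` with `ℓ₀ ≠ 0` in `K`: if the injectivity statement
`linearIndependent_tateModule_map ℓ₀` (Silverman, *AEC*, Thm. III.7.4: `ℤ`-independent isogenies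
`E → E` have `ℤ_{ℓ₀}`-independent Tate-module maps) holds, then the named fact
`isSemisimpleRepresentation_rationalGaloisRepTate_of_finite W ℓ` holds: for `K` finite and `E`
elliptic, `V_ℓ E` is a semisimple `ℚ_ℓ[Γ_K]`-module, for *every* prime `ℓ` (including
`ℓ = char K`). Chain: III.7.4 ⇒ `π` algebraic over `ℤ`
(`Isogeny.exists_aeval_eq_zero_of_linearIndependent`) ⇒
`isSemisimpleRepresentation_rationalGaloisRepTate_of_exists_aeval_eq_zero`.
Tate (1966), §1–2; Silverman, *AEC*, III.7.4, III.7.5, V.§2.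
[cite: Tate1966Endomorphisms, §1–2 (Main Theorem; π acts semisimply on V_ℓ)] -/
theorem isSemisimpleRepresentation_rationalGaloisRepTate_of_finite_of_linearIndependent
    {ℓ₀ : ℕ} [Fact ℓ₀.Prime] (hℓ₀ : (ℓ₀ : K) ≠ 0)
    (h : linearIndependent_tateModule_map.{u, 0} (W := W) (W' := W) ℓ₀) :
    isSemisimpleRepresentation_rationalGaloisRepTate_of_finite W ℓ := by
  intro _ _
  obtain ⟨σ, hσ⟩ := exists_frobenius_absoluteGaloisGroup K
  exact isSemisimpleRepresentation_rationalGaloisRepTate_of_exists_aeval_eq_zero W ℓ hσ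
    ((W.frobeniusIsogeny hσ).exists_aeval_eq_zero_of_linearIndependent hℓ₀ h)

/-- **Tate's semisimplicity theorem for elliptic curves, from the named facts of `IsogenyHom`.**
The named fact `isSemisimpleRepresentation_rationalGaloisRepTate_of_finite W ℓ` (Tate 1966:
`V_ℓ E` is a semisimple Galois module for `E` elliptic over a finite field, every prime `ℓ`)
follows from the two vendored inputs of Silverman's proof of *AEC* Thm. III.7.4 —
`Isogeny.exists_eq_comp_nsmul_of_geomTorsion_le_ker W W` (*AEC* Cor. III.4.11 with III.5.4) and
`fg_divHull_homModule W W` (statement `(*)` in the proof of *AEC* Thm. III.7.4) — through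
`linearIndependent_tateModule_map_of_facts₂` (file `FaltingsECProofs`; the third input
`mem_homModule_iff` is proved in the tree) at an auxiliary prime `ℓ₀ ∈ {2, 3}`, `ℓ₀ ≠ char K`
(`exists_prime_natCast_ne_zero` of `FaltingsECCardProofs`).
[cite: Tate1966Endomorphisms, §1–2 (Main Theorem; π acts semisimply on V_ℓ)] -/
theorem isSemisimpleRepresentation_rationalGaloisRepTate_of_finite_of_facts
    (h411 : Isogeny.exists_eq_comp_nsmul_of_geomTorsion_le_ker W W)
    (hdiv : fg_divHull_homModule W W) :
    isSemisimpleRepresentation_rationalGaloisRepTate_of_finite W ℓ := by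
  intro _ _
  obtain ⟨ℓ₀, hprime, hℓ₀⟩ := exists_prime_natCast_ne_zero K
  haveI : Fact ℓ₀.Prime := ⟨hprime⟩
  exact isSemisimpleRepresentation_rationalGaloisRepTate_of_finite_of_linearIndependent W ℓ hℓ₀
    (linearIndependent_tateModule_map_of_facts₂ ℓ₀ (mem_homModule_iff_holds W W) h411 hdiv)

/-- **Tate's semisimplicity theorem for elliptic curves, from the trace and determinant of
Frobenius** (Silverman's route, *AEC*, V.§2): if at one prime `ℓ₀ ≠ char k` the Frobenius
`φ_{ℓ₀} = ρ_{ℓ₀}(σ_q)` on `T_{ℓ₀} E` has `tr(φ_{ℓ₀}) = q + 1 - #E(k)` and `det(φ_{ℓ₀}) = q`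
(Thm. V.2.3.1 — the named facts `trace_galoisRepTate_frobenius W ℓ₀` and
`det_galoisRepTate_frobenius W ℓ₀` of `EllipticCurves/FrobeniusTateModule`), then `π² - aπ + q = 0`
in `End(E)` (`aeval_frobenius_eq_zero_of_trace_det`), so `π` is algebraic over `ℤ` and the named
fact `isSemisimpleRepresentation_rationalGaloisRepTate_of_finite W ℓ` holds for every prime `ℓ`.
[cite: Tate1966Endomorphisms, §1–2 (Main Theorem; π acts semisimply on V_ℓ)] -/
theorem isSemisimpleRepresentation_rationalGaloisRepTate_of_finite_of_trace_det
    {ℓ₀ : ℕ} [Fact ℓ₀.Prime] (hℓ₀ : (ℓ₀ : K) ≠ 0) (htr : W.trace_galoisRepTate_frobenius ℓ₀)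
    (hdet : W.det_galoisRepTate_frobenius ℓ₀) :
    isSemisimpleRepresentation_rationalGaloisRepTate_of_finite W ℓ := by
  intro _ _
  obtain ⟨σ, hσ⟩ := exists_frobenius_absoluteGaloisGroup K
  exact isSemisimpleRepresentation_rationalGaloisRepTate_of_exists_aeval_eq_zero W ℓ hσ
    ⟨_, X_sq_sub_C_mul_X_add_C_ne_zero _ _,
      W.aeval_frobenius_eq_zero_of_trace_det hσ hℓ₀ (hdet hℓ₀ σ hσ) (htr hℓ₀ σ hσ)⟩

/-- **Tate's semisimplicity theorem for elliptic curves, from the named facts of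
`FrobeniusEndomorphism`** (Silverman's route in full): the named fact
`isSemisimpleRepresentation_rationalGaloisRepTate_of_finite W ℓ` follows, for every prime `ℓ`,
from *AEC* Prop. III.8.6 (`det(ψ_ℓ₀) = deg ψ`, fact `Isogeny.det_tateModule_map_eq_deg W ℓ₀` at one
prime `ℓ₀ ≠ char K`), Prop. II.2.11(c) (`deg φ = q`, `frobeniusIsogeny_deg_eq_card`),
Thm. III.4.10(a) (`#ker = deg_s`, `Isogeny.card_ker_eq_finSepDegree W W` of `IsogenyDegree`) and
Cor. III.5.5 (`1 - φ` separable, `isSeparable_oneSubFrobeniusIsogeny`), through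
`det/trace_galoisRepTate_frobenius_of_facts` of `FrobeniusEndomorphism` and
`aeval_frobenius_eq_zero_of_trace_det`.
[cite: Tate1966Endomorphisms, §1–2 (Main Theorem; π acts semisimply on V_ℓ)] -/
theorem isSemisimpleRepresentation_rationalGaloisRepTate_of_finite_of_frobenius_facts
    {ℓ₀ : ℕ} [Fact ℓ₀.Prime] (hℓ₀ : (ℓ₀ : K) ≠ 0)
    (h86 : Isogeny.det_tateModule_map_eq_deg W ℓ₀) (hdeg : W.frobeniusIsogeny_deg_eq_card)
    (h410 : Isogeny.card_ker_eq_finSepDegree W W) (h55 : W.isSeparable_oneSubFrobeniusIsogeny) :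
    isSemisimpleRepresentation_rationalGaloisRepTate_of_finite W ℓ := by
  intro _ _
  obtain ⟨σ, hσ⟩ := exists_frobenius_absoluteGaloisGroup K
  exact isSemisimpleRepresentation_rationalGaloisRepTate_of_exists_aeval_eq_zero W ℓ hσ
    ⟨_, X_sq_sub_C_mul_X_add_C_ne_zero _ _, W.aeval_frobenius_eq_zero_of_trace_det hσ hℓ₀
      (det_galoisRepTate_frobenius_of_facts W ℓ₀ h86 hdeg hℓ₀ hσ)
      (trace_galoisRepTate_frobenius_of_facts W ℓ₀ h86 hdeg h410 h55 hℓ₀ hσ)⟩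

end Literature.AlgebraicGeometry.Motives

/-! ## Appendix: the route through Silverman III.8.6 alone

The reductions above make `π` algebraic over `ℤ` either from *AEC* Thm. III.7.4
(`…_of_linearIndependent`) or from the *values* `tr π_ℓ₀ = q + 1 - #E(k)`, `det π_ℓ₀ = q` of
*AEC* Thm. V.2.3.1 (`…_of_trace_det`, `…_of_frobenius_facts`, the latter consuming four named
facts). For semisimplicity only the *integrality* of the characteristic polynomial of `π_ℓ₀`
matters, and that already follows from *AEC* Prop. III.8.6 (`det χ_ℓ₀ = deg χ` for the isogenies
`χ : E → E` over `K`, the single named fact `Isogeny.det_tateModule_map_eq_deg W ℓ₀` of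
`Literature.NumberTheory.EllipticCurves.FrobeniusEndomorphism`): `det φ_ℓ₀ = deg φ` and
`det(1 - φ_ℓ₀) = deg(1 - φ)` are natural numbers, so `tr φ_ℓ₀ = 1 + det φ_ℓ₀ - det(1 - φ_ℓ₀)`
(the tree's `trace_eq_one_add_det_sub_det`) is an integer — for *every* `φ ∈ End_K(E)` over any
field. Hence the named fact `isSemisimpleRepresentation_rationalGaloisRepTate_of_finite` is reduced
to III.8.6 at one prime `ℓ₀ ≠ char k` alone (`…_of_det_eq_deg`). (The named fact itself is
discharged unconditionally in the sibling module
`Literature.AlgebraicGeometry.Motives.FaltingsECSemisimpleFiniteProofs`, which imports this file,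
from Manin's elementary proof of `π² - aπ + q = 0` in
`Literature.NumberTheory.EllipticCurves.FrobeniusManinProofs`; the present reduction is recorded
because its first step applies to every endomorphism over every field.) -/

namespace WeierstrassCurve.Isogeny

open Polynomial Literature.NumberTheory.EllipticCurves Literature.AlgebraicGeometry.Motives

variable {K : Type u} [Field K] {W : WeierstrassCurve K}

/-- **Endomorphisms are quadratic integers, from Silverman III.8.6.** For `E` elliptic over any
field `K`, a prime `ℓ₀ ≠ char K` at which `det χ_ℓ₀ = deg χ` holds for the isogenies `χ : E → E`
over `K` (the named fact `Isogeny.det_tateModule_map_eq_deg W ℓ₀`, Silverman, *AEC*,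
Prop. III.8.6), every `φ ∈ End_K(E)` satisfies a non-zero — indeed monic quadratic — integer
polynomial: either `1 - φ = 0`, or `1 - φ` is an isogeny `χ` ("`Hom` is a group",
`mem_homModule_iff_holds`), and then `det φ_ℓ₀ = deg φ` and `det(1 - φ_ℓ₀) = deg χ` are natural
numbers, so `tr φ_ℓ₀ = 1 + det φ_ℓ₀ - det(1 - φ_ℓ₀)` (`trace_eq_one_add_det_sub_det`) is an
integer; the characteristic polynomial `X² - tr(φ_ℓ₀) X + det(φ_ℓ₀)` of `φ_ℓ₀` on
`T_ℓ₀ E ≅ ℤ_ℓ₀²` thus has integer coefficients, kills `φ_ℓ₀` (Cayley–Hamilton,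
`aeval_charpoly_tateModule_eq_zero`) and hence kills `φ` in `End_K(E)`
(`aeval_eq_zero_of_aeval_tateEndRingHom_eq_zero`). This is Silverman's deduction
"`det(φ_ℓ) = deg φ ∈ ℤ`, `tr(φ_ℓ) = 1 + deg φ - deg(1 - φ) ∈ ℤ`, so `φ² - tr(φ_ℓ)φ + deg φ = 0`"
(proof of Thm. V.2.3.1 from Prop. V.2.3 = III.8.6), for an arbitrary endomorphism and without
evaluating trace and determinant. [cite: SilvermanAEC2009, Prop. III.8.6 and Thm. V.2.3.1 (proof)] -/
theorem exists_aeval_eq_zero_of_det_eq_deg [W.IsElliptic] (φ : Isogeny W W)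
    {ℓ₀ : ℕ} [Fact ℓ₀.Prime] (hℓ₀ : (ℓ₀ : K) ≠ 0) (h86 : Isogeny.det_tateModule_map_eq_deg W ℓ₀) :
    ∃ f : ℤ[X], f ≠ 0 ∧
      Polynomial.aeval (⟨φ.toAddMonoidHom, φ.toAddMonoidHom_mem_endRing⟩ : W.endRing) f = 0 := by
  set π : W.endRing := ⟨φ.toAddMonoidHom, φ.toAddMonoidHom_mem_endRing⟩ with hπ
  -- `1 - φ ∈ Hom_K(E, E)` is `0` or an isogeny `χ`
  have hmem : ((Polynomial.aeval π (1 - X : ℤ[X]) : W.endRing) : AddMonoid.End W.geomPoints) ∈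
      homModule W W :=
    φ.coe_aeval_mem_homModule _
  rcases (mem_homModule_iff_holds (W := W) (W' := W) _).mp hmem with h0 | ⟨χ, hχ⟩
  · refine ⟨1 - X, fun h ↦ ?_, Subtype.ext h0⟩
    have := congrArg (fun g : ℤ[X] ↦ g.coeff 0) h
    simp at this
  · -- the Tate-module maps `F = φ_ℓ₀` and `1 - F = χ_ℓ₀`
    set F : Module.End ℤ_[ℓ₀] (W.tateModule ℓ₀) := Literature.AlgebraicGeometry.Motives.tateEndRingHom W ℓ₀ π with hF
    have hdet : LinearMap.det F = (φ.deg : ℤ_[ℓ₀]) := by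
      rw [hF, Literature.AlgebraicGeometry.Motives.tateEndRingHom_apply]
      exact h86 hℓ₀ φ
    have hTχ : TateModule.map ℓ₀ χ.toAddMonoidHom = LinearMap.id - F := by
      rw [hχ, ← Literature.AlgebraicGeometry.Motives.tateEndRingHom_apply,
        show Literature.AlgebraicGeometry.Motives.tateEndRingHom W ℓ₀ (Polynomial.aeval π (1 - X : ℤ[X])) =
          (Literature.AlgebraicGeometry.Motives.tateEndRingHom W ℓ₀).toIntAlgHom (Polynomial.aeval π (1 - X : ℤ[X])) from rfl,
        ← Polynomial.aeval_algHom_apply, map_sub, map_one, aeval_X]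
      rfl
    have hdet' : LinearMap.det (LinearMap.id - F) = (χ.deg : ℤ_[ℓ₀]) := by
      rw [← hTχ]
      exact h86 hℓ₀ χ
    -- so the trace is an integer
    have htr : LinearMap.trace ℤ_[ℓ₀] _ F = 1 + (φ.deg : ℤ_[ℓ₀]) - χ.deg := by
      rw [trace_eq_one_add_det_sub_det hℓ₀ F, hdet, hdet']
    refine ⟨X ^ 2 - C ((1 : ℤ) + φ.deg - χ.deg) * X + C (φ.deg : ℤ),
      X_sq_sub_C_mul_X_add_C_ne_zero _ _, φ.aeval_eq_zero_of_aeval_tateEndRingHom_eq_zero hℓ₀ ?_⟩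
    -- Cayley–Hamilton on `T_ℓ₀ E`, with integer coefficients
    have hcp := W.aeval_charpoly_tateModule_eq_zero hℓ₀ F
    rw [htr, hdet] at hcp
    rw [← hF]
    simp only [map_add, map_sub, map_mul, map_pow, aeval_X, map_one, map_natCast] at hcp ⊢
    exact hcp

end WeierstrassCurve.Isogeny

namespace Literature.AlgebraicGeometry.Motives

open WeierstrassCurve Polynomial

variable {K : Type u} [Field K] (W : WeierstrassCurve K) (ℓ : ℕ) [Fact ℓ.Prime]

/-- **Tate's semisimplicity theorem for elliptic curves, from Silverman III.8.6 alone.** The named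
fact `isSemisimpleRepresentation_rationalGaloisRepTate_of_finite W ℓ` (Tate (1966), Main Theorem:
`V_ℓ E` is a semisimple `ℚ_ℓ[Γ_k]`-module for `E` elliptic over a finite field `k`, every prime
`ℓ`) follows from `det χ_ℓ₀ = deg χ` for the isogenies `χ : E → E` over `k` at one prime
`ℓ₀ ≠ char k` (the named fact `Isogeny.det_tateModule_map_eq_deg W ℓ₀` of `FrobeniusEndomorphism`;
Silverman, *AEC*, Prop. III.8.6), which already makes the Frobenius endomorphism `π` a quadratic
integer (`Isogeny.exists_aeval_eq_zero_of_det_eq_deg`); the values `tr π_ℓ₀ = q + 1 - #E(k)`,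
`det π_ℓ₀ = q` of Thm. V.2.3.1 (route `…_of_frobenius_facts`) are not needed for semisimplicity.
[cite: Tate1966Endomorphisms, §1–2 (Main Theorem; π acts semisimply on V_ℓ)] -/
theorem isSemisimpleRepresentation_rationalGaloisRepTate_of_finite_of_det_eq_deg
    {ℓ₀ : ℕ} [Fact ℓ₀.Prime] (hℓ₀ : (ℓ₀ : K) ≠ 0)
    (h86 : Isogeny.det_tateModule_map_eq_deg W ℓ₀) :
    isSemisimpleRepresentation_rationalGaloisRepTate_of_finite W ℓ := by
  intro _ _
  obtain ⟨σ, hσ⟩ := exists_frobenius_absoluteGaloisGroup K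
  exact isSemisimpleRepresentation_rationalGaloisRepTate_of_exists_aeval_eq_zero W ℓ hσ
    ((W.frobeniusIsogeny hσ).exists_aeval_eq_zero_of_det_eq_deg hℓ₀ h86)

end Literature.AlgebraicGeometry.Motives
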